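import Summits.KontsevichZagierPeriods.KontsevichZagierPeriods.Theorems.ValuedFieldSpecialisationParametricLiftingStrata

/-!
# Route ValuedFieldSpecialisation — crux `ParametricLifting` (stmt-KontsevichZagierPeriods-3498):
# graded special-fibre rigidity on the RATIONAL sub-rung of level 2, unconditionally (lead c9, sub-goal W4)

Helper (`--supports stmt-KontsevichZagierPeriods-3498`) for line `registered`. Write level `E` :=
`AddSubgroup.closure {[r] | dim r < E}`. The special-fibre rigidity SF of the route ("the special fibres
`r₀ᵢ` of DOMINATED families `Rᵢ` whose combination `Σ mᵢ [Rᵢ]` is a FIBRED relation satisfy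
`Σ mᵢ [r₀ᵢ] ∈ KZ.relations`") is open in general; graded by the fibre dimension it is implied, level by
level, by the kernel conjecture on that level (value shadow + level membership). This file records its
first UNCONDITIONAL instance above the constants:

* `stub_specialFibreGraded_two_rational` — SF for special fibres of KZ's RATIONAL shape and of dimension
  `≤ 1` (constants, and rational integrands over `ℚ`-semialgebraic subsets of the line: logarithms of
  rationals and rational multiples of `π`). Proof: the value shadow `eval_specialFibre_eq_zero`
  (`…ParametricLiftingStrength.lean`) puts `Σ mᵢ [r₀ᵢ]` in `ker KZ.eval`; it lies on the rational
  sub-level `AddSubgroup.closure {[r] | dim r < 2, r rational}`; and the kernel conjecture on that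
  sub-level is the tree theorem `kernelLevelTwo_rational` (`…ParametricLiftingStrata.lean`, lead c8;
  Baker's theorem on linear forms in logarithms inside, via `Port.Dlog`).

Sources: M. Kontsevich, D. Zagier, *Periods* (2001), §1.2, Conjecture 1 (the moves and the conjecture);
A. Baker, *Transcendental Number Theory* (1975), Thm. 2.1 (linear forms in logarithms — the transcendence
input of the rational level-2 kernel theorem already in the tree). The fibred / dominated vocabulary is this
route's (`KZFibredRelations.lean`, `KZDominatedFamily.lean`). No definitions.
-/

noncomputable section

namespace Summit.KontsevichZagierPeriods.ValuedFieldSpecialisation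

open MeasureTheory Set Filter
open scoped Topology
open Literature.NumberTheory.Transcendental

/-- **Graded special-fibre rigidity, rational sub-rung of level 2, unconditionally** (lead c9 sub-goal W4):
if every dominated family `Rᵢ` has a special fibre `r₀ᵢ` of KZ's rational shape and of dimension `< 2`,
and `Σ mᵢ [Rᵢ]` is a fibred relation, then `Σ mᵢ [r₀ᵢ] ∈ KZ.relations`. The value shadow
`eval_specialFibre_eq_zero` gives `KZ.eval (Σ mᵢ [r₀ᵢ]) = 0`, the class lies on the rational sub-level of
level `2`, and there the kernel conjecture is the theorem `kernelLevelTwo_rational` (Baker 1975, Thm. 2.1,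
inside). [cite: KontsevichZagier2001, §1.2 Conjecture 1] -/
theorem stub_specialFibreGraded_two_rational : ∀ (k : ℕ) (d : Fin k → ℕ) (m : Fin k → ℤ) (R : (i : Fin k) → KZ.IntegralRep (d i + 1)) (r₀ g : (i : Fin k) → KZ.IntegralRep (d i)), (∀ i, d i < 2) → (∀ i, (r₀ i).IsRational) → (∀ i, KZ.IsDominatedFamily (R i) (r₀ i) (g i)) → (∑ i, m i • KZ.of (R i)) ∈ KZ.fibredRelations → (∑ i, m i • KZ.of (r₀ i)) ∈ KZ.relations := by
  intro k d m R r₀ g hd hrat hR hG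
  -- (1) the value shadow: the special-fibre class of a dominated fibred relation has value `0`
  have h0 : KZ.eval (∑ i, m i • KZ.of (r₀ i)) = 0 := eval_specialFibre_eq_zero m hR hG
  -- (2) the class lies on the rational sub-level of level `2`
  have hmem : (∑ i, m i • KZ.of (r₀ i)) ∈ AddSubgroup.closure
      {y : KZ.FormalRep | ∃ (n : ℕ) (r : KZ.IntegralRep n), n < 2 ∧ r.IsRational ∧ y = KZ.of r} := by
    refine AddSubgroup.sum_mem _ fun i _ => AddSubgroup.zsmul_mem _ (AddSubgroup.subset_closure ?_) _
    exact ⟨d i, r₀ i, hd i, hrat i, rfl⟩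
  -- (3) the kernel conjecture on that sub-level is a theorem (Baker)
  exact kernelLevelTwo_rational _ hmem h0

end Summit.KontsevichZagierPeriods.ValuedFieldSpecialisation
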